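/-
Copyright (c) 2026 the pub-hodgecm-mathlib formalisation cell (harness21).  Prover seat hodgecm-mathlib-LH4-p02 (g7) on planner LH4-plan (g6) WORD #7 «M3-D READING»
(2026-09-02); dyadic sibling of ★ `FinExplicitTransferFactorInertExponent` §3 (B-p14 (g30) ∕ A-p06 (g26) lineage).
-/
import Literature.NumberTheory.Rogawski1990.FinExplicitTransferFactorInertExponent   -- ★ §3 bridge `eval_finCharpolyTwo_finGammaTwo_apply_eq_quadratic`; brings ★ (D2) `FinExplicitTransferFactorInertPlaceValuation`
import Literature.NumberTheory.LocalFields.DyadicQuadraticEvalOrder                  -- ★ p851512 (W1′) `valued_quadratic_eval_of_ne`, (W2) `valued_four_mul_quadratic_eval_of_eq`, (W2d) `valued_le_valued_mul_self_sub_one_add`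
import HarnessLib

/-!
# The `Δ‴`-exponent of a type-(2) class at an inert place of ANY residue characteristic: `ord_w χ_g(u) = min(D, 2M) − 2e` (domination row) and
# `= 2r + J − 2e` (cancellation row), `e = ord_w 2` (Flicker 1998 §6 Thm. 18; Rogawski 1990 §4.9 p. 55 — read without `|2|_w = 1`)

Topic `NumberTheory/Rogawski1990`; namespace `Literature.NumberTheory.Rogawski1990`.  THEOREMS ONLY (no definition, no named fact, no instance, no notation, no `sorry`;
count-neutral for the books); kernel lane `--supports stmt-HodgeConjecture-24833`.  Cell `pub/hodgecm-mathlib` (D-0151), crux H413 = `stmt-HodgeConjecture-24833`, half A line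
LH4 (closer row `stub_N6ns` CLOSED-DERIVED; live residual row #183 «LT-DYADIC» PRINT [LS₂]; (D-UNR)∕(D-RAM) PRINT by desk D74′ ∕ census OUTCOME B).  Brick «M3-D READING»
(planner LH4-plan (g6) WORD #3∕#7): the `D`-part of mechanism M3 (the `Δ‴_v`-exponent on WILD type-(2) tori, census F0P3a-p06 (g17) `DUNR-H2-CENSUS` §1 row M3) — the dyadic
sibling of ★ `FinExplicitTransferFactorInertExponent` §3 (`log_valued_eval_finCharpolyTwo_apply_eq_neg_min` :295, `finExplicitDelta_eq_neg_absNorm_zpow_neg_min_mul_kappa` :349,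
both under `h2 : v_w(2) = 1`) with `h2` REPLACED by `he : v_w(2) = exp(−e)` and the exponent read through ★ `LocalFields/DyadicQuadraticEvalOrder` (p851512).  Pays no organ,
opens no road.  HONEST LABEL: HC_CM is proved only modulo the 7 printed citations (2 remaining: hLiu418 = stmt-HodgeConjecture-24832, h413 = stmt-HodgeConjecture-24833)
until rung 0 closes.

THE MATHEMATICS.  `γ_H = (g, u) ∈ H_v = U(2) × U(1)` at a non-split place `v` of `L⁺` UNRAMIFIED in `L` (so `q_w = q_v²`), `w ∣ v`, `g_w := g.map eval_w`, `b := u_w`, `t := tr g_w`,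
`δ := det g_w`, `χ_g(u)_w = b² − t b + δ` (★ bridge :276), `4·χ_g(u)_w = (t − 2b)² − (t² − 4δ)`; `e := ord_w 2` (`e = 0` off `2`; at `v ∣ 2` inert-unramified `e = ord_v 2`).
Write `v_w(t² − 4δ) = exp(−D)`, `v_w(t − 2b) = exp(−M)`.  ★ (D2) `finExplicitDelta_eq_neg_absNorm_zpow_mul_kappa_of_nonsplit_of_isUnramifiedIn` reads
`Δ‴_v(γ_H, γ′) = (−q_v)^{log v_w(χ_g(u)_w)} · κ_v` with an INTEGER (`zpow`) exponent, so both rows below plug in verbatim: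
* (M3a∕b) DOMINATION ROW `D ≠ 2M`: `log v_w(χ_g(u)_w) = 2e − min(D, 2M)` and `Δ‴_v = (−q_v)^{2e − min(D, 2M)} · κ_v`.  For the splitting field `K₂ = L_w[g]` of different
  exponent `d(K₂∕L_w) = 2e + 1` (`D = 2e + 1 + 2j(g)` odd — always domination) this is the ODD COLUMN VERBATIM with `N ↦ j(g)`, `M ↦ M − e`: `n = min(2j+1, 2(M − e))`;
  at `e = 0` it is ★ :295∕:349 (there `D = 2N + 1`).
* (M3c) CANCELLATION ROW `D = 2M =: 2r` (only `d(K₂∕L_w) = 2k` even, `r = k + j(g)`; forced when `k + j(g) < e`): with a uniformiser `ϖ_w`, `c₀ := (t − 2b)∕ϖ^r`, `η := (t² − 4δ)∕ϖ^{2r}`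
  (units), `v_w(c₀² − η) = exp(−J)`: `log v_w(χ_g(u)_w) = 2e − 2r − J`... read with the sign of an ORDER: `ord_w χ_g(u) = 2r + J − 2e`, `Δ‴_v = (−q_v)^{2e − 2r − J} · κ_v`.
* (M3d) THE DEFECT BOUND in consumer shape: if `η·y² = 1 + w₀` for a unit `y` with `v 4 < v w₀` and `v w₀` not a square value (`η` of ODD defect `s = ord w₀ = 2e + 1 − d`, the normal
  form of ★ (C4) `exists_unit_mul_sq_depth_dichotomy`), then `v w₀ ≤ v(x·x − η)` for every `x` (§1, from ★ (W2d)), so `exp(−J) ≥ v w₀`: **`J ≤ s`**; the value set of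
  `n = ord_w χ_g(u)` is `{0, 2, …, 2j(g)} ∪ {2j(g)+1}` in every family (words; the Rogawski-side different∕conductor dictionary `D = d + 2j(g)` is ★ `RamifiedPlaceOrderDiscriminant`).
The unit hypothesis `hu : IsUnit χ_g(u)` of ★ :349 is automatic from `hD`∕`hM` and DERIVED here (one place over `v`: ★ `isUnit_localRing_of_ne_zero_of_subsingleton`).
At `e = 0` (M3a∕b) specialise to ★ :295∕:349 with `D = 2N + 1`; the cancellation row (M3c) has no odd-characteristic instance because `ord_w disc χ_{g,w}` is odd there
(★ `LocalIrreducibleTorusDiscriminantOdd.exists_valued_disc_eq_exp_neg_odd_of_not_exists_isRoot`) — it is the genuinely WILD row (`d(K₂∕L_w)` even, `v ∣ 2`).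

* §1 valued-field rows at `L_w` (`v_w(2) = exp(−e)`): `log_valued_quadratic_eval_eq_of_ne`, `valued_quadratic_eval_eq_exp_of_eq`, `log_valued_quadratic_eval_eq_of_eq`,
  `valued_mul_sq_sub_one_le_valued_mul_self_sub` (M3d), `valued_mul_sq_sub_one_le_of_eq` (M3d at `c₀`: `v w₀ ≤ exp(−J)`).
* §2 on the CM carriers: `isUnit_eval_finCharpolyTwo_of_valued_apply_ne_zero`, (M3a) `log_valued_eval_finCharpolyTwo_apply_eq_of_ne`, (M3b)
  `finExplicitDelta_eq_neg_absNorm_zpow_of_ne_mul_kappa`, (M3c) `log_valued_eval_finCharpolyTwo_apply_eq_of_eq`, `finExplicitDelta_eq_neg_absNorm_zpow_of_eq_mul_kappa`.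

## References
* [Flicker1998UnitaryFL] Y. Z. Flicker, *Elementary proof of the fundamental lemma for a unitary group*, Canad. J. Math. 50 (1998), §6 Thm. 18 p. 97 (`n = min(1+2N, 2+2N₂)`, `p > 2`).
* [Rogawski1990] J. D. Rogawski, *Automorphic Representations of Unitary Groups in Three Variables*, Ann. of Math. Stud. 123 (1990), §4.9 p. 55, Prop. 4.9.1 (b).
* [Omeara1963] O. T. O'Meara, *Introduction to Quadratic Forms* (1963), §11 (domination), §63A 63:2–63:5 (quadratic defect).
* [LanglandsShelstad1987] R. P. Langlands, D. Shelstad, *On the definition of transfer factors*, Math. Ann. 278 (1987) (`Δ_{III₂}·Δ_{IV}` at every residue characteristic).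
-/

set_option autoImplicit false

noncomputable section

open NumberField IsDedekindDomain Matrix Polynomial
open scoped MatrixGroups

namespace Literature.NumberTheory.Rogawski1990

open Literature.NumberTheory.Automorphic Literature.NumberTheory.GaloisRepresentations Literature.NumberTheory.QuadraticForms
open Literature.NumberTheory.NumberFields Literature.NumberTheory.LocalFields

variable (L : Type) [Field L] [NumberField L] [IsCMField L] (v : HeightOneSpectrum (𝓞 ↥(maximalRealSubfield L)))
  (w : UnitaryGroup.PlacesOver L v)

/-! ## §1 Valued-field rows at `L_w` with `v_w(2) = exp(−e)` -/

section ValuedField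

open scoped Valued

omit [IsCMField L] in
/-- **DOMINATION ROW at `L_w`, `log` form**: `v_w(2) = exp(−e)`, `v_w(t² − 4d) = exp(−D)`, `v_w(t − 2b) = exp(−M)`, `D ≠ 2M` ⇒ `log v_w(b² − tb + d) = 2e − min(D, 2M)`
(★ (W1′) `LocalFields.valued_quadratic_eval_of_ne`).  At `e = 0`, `D = 2N+1`: ★ `log_valued_quadratic_eval_eq_neg_min`. [cite: Flicker1998UnitaryFL, §6 Thm. 18 p. 97] [cite: Omeara1963, §11] -/
theorem log_valued_quadratic_eval_eq_of_ne {e D M : ℕ} (he : Valued.v (2 : w.1.adicCompletion L) = WithZero.exp (-(e : ℤ))) {t d b : w.1.adicCompletion L}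
    (hD : Valued.v (t ^ 2 - 4 * d) = WithZero.exp (-(D : ℤ))) (hM : Valued.v (t - 2 * b) = WithZero.exp (-(M : ℤ))) (hne : D ≠ 2 * M) :
    WithZero.log (Valued.v (b ^ 2 - t * b + d)) = 2 * (e : ℤ) - ((min D (2 * M) : ℕ) : ℤ) := by
  rw [valued_quadratic_eval_of_ne he hD hM hne, WithZero.log_exp]

omit [IsCMField L] in
/-- **CANCELLATION ROW at `L_w`**: `v_w(2) = exp(−e)`, a uniformiser `ϖ`, `v_w(t² − 4d) = exp(−2r)`, `v_w(t − 2b) = exp(−r)`, and `v_w(c₀² − η) = exp(−J)` for the units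
`c₀ = (t − 2b)∕ϖ^r`, `η = (t² − 4d)∕ϖ^{2r}` (★ (W2) `LocalFields.valued_four_mul_quadratic_eval_of_eq`) ⇒ `v_w(b² − tb + d) = exp(2e − (2r + J))`.
[cite: Omeara1963, §63A 63:2–63:5] [cite: Flicker1998UnitaryFL, §6 Thm. 18 p. 97] -/
theorem valued_quadratic_eval_eq_exp_of_eq {e r J : ℕ} (he : Valued.v (2 : w.1.adicCompletion L) = WithZero.exp (-(e : ℤ))) {ϖ t d b : w.1.adicCompletion L}
    (hϖ : Valued.v ϖ = WithZero.exp (-1 : ℤ)) (hD : Valued.v (t ^ 2 - 4 * d) = WithZero.exp (-((2 * r : ℕ) : ℤ)))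
    (hM : Valued.v (t - 2 * b) = WithZero.exp (-(r : ℤ)))
    (hJ : Valued.v (((t - 2 * b) / ϖ ^ r) ^ 2 - (t ^ 2 - 4 * d) / ϖ ^ (2 * r)) = WithZero.exp (-(J : ℤ))) :
    Valued.v (b ^ 2 - t * b + d) = WithZero.exp (2 * (e : ℤ) - (2 * (r : ℤ) + (J : ℤ))) := by
  have h4 : Valued.v (4 : w.1.adicCompletion L) = WithZero.exp (-(2 * (e : ℤ))) := by
    rw [show (4 : w.1.adicCompletion L) = 2 * 2 by norm_num, map_mul, he, ← WithZero.exp_add]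
    congr 1; ring
  have h := (valued_four_mul_quadratic_eval_of_eq hϖ hD hM).2.2
  rw [hJ, map_mul, h4, ← WithZero.exp_add] at h
  calc Valued.v (b ^ 2 - t * b + d)
      = (WithZero.exp (-(2 * (e : ℤ))))⁻¹ * (WithZero.exp (-(2 * (e : ℤ))) * Valued.v (b ^ 2 - t * b + d)) := by
        rw [inv_mul_cancel_left₀ WithZero.exp_ne_zero]
    _ = WithZero.exp (2 * (e : ℤ) - (2 * (r : ℤ) + (J : ℤ))) := by
        rw [h, ← WithZero.exp_neg, ← WithZero.exp_add]
        congr 1; push_cast; ring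

omit [IsCMField L] in
/-- … in `log` form: `log v_w(b² − tb + d) = 2e − (2r + J)`. [cite: Omeara1963, §63A 63:2–63:5] [cite: Flicker1998UnitaryFL, §6 Thm. 18 p. 97] -/
theorem log_valued_quadratic_eval_eq_of_eq {e r J : ℕ} (he : Valued.v (2 : w.1.adicCompletion L) = WithZero.exp (-(e : ℤ))) {ϖ t d b : w.1.adicCompletion L}
    (hϖ : Valued.v ϖ = WithZero.exp (-1 : ℤ)) (hD : Valued.v (t ^ 2 - 4 * d) = WithZero.exp (-((2 * r : ℕ) : ℤ)))
    (hM : Valued.v (t - 2 * b) = WithZero.exp (-(r : ℤ)))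
    (hJ : Valued.v (((t - 2 * b) / ϖ ^ r) ^ 2 - (t ^ 2 - 4 * d) / ϖ ^ (2 * r)) = WithZero.exp (-(J : ℤ))) :
    WithZero.log (Valued.v (b ^ 2 - t * b + d)) = 2 * (e : ℤ) - (2 * (r : ℤ) + (J : ℤ)) := by
  rw [valued_quadratic_eval_eq_exp_of_eq L v w he hϖ hD hM hJ, WithZero.log_exp]

omit [IsCMField L] in
/-- **(M3d) THE DEFECT BOUND, consumer shape**: if `η·(y·y) = 1 + w₀` for a unit `y` with `v 4 < v w₀` and `v w₀` not a square value (the ODD-defect branch of the normal form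
★ (C4) `LocalFields.exists_unit_mul_sq_depth_dichotomy`, `s = ord w₀`), then `v w₀ ≤ v(x·x − η)` for every `x` — `x·x − η = (y·y)⁻¹·((x·y)·(x·y) − (1 + w₀))` and ★ (W2d)
`LocalFields.valued_le_valued_mul_self_sub_one_add` at `x·y`. [cite: Omeara1963, §63A 63:2–63:5] -/
theorem valued_mul_sq_sub_one_le_valued_mul_self_sub {η y w₀ : w.1.adicCompletion L} (hy : Valued.v y = 1) (hη : η * (y * y) = 1 + w₀)
    (h4 : Valued.v (4 : w.1.adicCompletion L) < Valued.v w₀) (hodd : ∀ z : w.1.adicCompletion L, Valued.v w₀ ≠ Valued.v z * Valued.v z)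
    (x : w.1.adicCompletion L) : Valued.v w₀ ≤ Valued.v (x * x - η) := by
  have hy0 : y ≠ 0 := by
    intro h
    rw [h, map_zero] at hy
    exact zero_ne_one hy
  have key : x * x - η = (y * y)⁻¹ * ((x * y) * (x * y) - (1 + w₀)) := by
    rw [← hη]
    field_simp
  rw [key, map_mul, map_inv₀, map_mul, hy, one_mul, inv_one, one_mul]
  exact valued_le_valued_mul_self_sub_one_add h4 hodd (x * y)

omit [IsCMField L] in
/-- **(M3d) at `x = c₀`: `J ≤ s`** — if `v(c₀·c₀ − η) = exp(−J)` then `v w₀ ≤ exp(−J)` (so with `v w₀ = exp(−s)`: `J ≤ s`). [cite: Omeara1963, §63A 63:2–63:5] -/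
theorem valued_mul_sq_sub_one_le_of_eq {η y w₀ c₀ : w.1.adicCompletion L} (hy : Valued.v y = 1) (hη : η * (y * y) = 1 + w₀)
    (h4 : Valued.v (4 : w.1.adicCompletion L) < Valued.v w₀) (hodd : ∀ z : w.1.adicCompletion L, Valued.v w₀ ≠ Valued.v z * Valued.v z) {J : ℕ}
    (hJ : Valued.v (c₀ ^ 2 - η) = WithZero.exp (-(J : ℤ))) : Valued.v w₀ ≤ WithZero.exp (-(J : ℤ)) := by
  rw [← hJ, pow_two]
  exact valued_mul_sq_sub_one_le_valued_mul_self_sub L v w hy hη h4 hodd c₀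

omit [IsCMField L] in
/-- … with `v w₀ = exp(−s)`: **`J ≤ s`** as natural numbers. [cite: Omeara1963, §63A 63:2–63:5] -/
theorem le_of_valued_mul_sq_sub_one_eq_exp {η y w₀ c₀ : w.1.adicCompletion L} (hy : Valued.v y = 1) (hη : η * (y * y) = 1 + w₀)
    (h4 : Valued.v (4 : w.1.adicCompletion L) < Valued.v w₀) (hodd : ∀ z : w.1.adicCompletion L, Valued.v w₀ ≠ Valued.v z * Valued.v z) {s J : ℕ}
    (hs : Valued.v w₀ = WithZero.exp (-(s : ℤ))) (hJ : Valued.v (c₀ ^ 2 - η) = WithZero.exp (-(J : ℤ))) : J ≤ s := by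
  have h := valued_mul_sq_sub_one_le_of_eq L v w hy hη h4 hodd hJ
  rw [hs, WithZero.exp_le_exp] at h
  omega

end ValuedField

/-! ## §2 On the CM carriers: `ord_w χ_g(u)` and `Δ‴_v` without `|2|_w = 1` -/

section Carriers

open scoped Valued

variable (a : (UnitaryGroup.cmDatum L 2 (Matrix.of fun i j : Fin 2 => if i.val + j.val + 1 = 2 then (1 : L) else 0)).Local v ×
      (UnitaryGroup.cmDatum L 1 (Matrix.of fun i j : Fin 1 => if i.val + j.val + 1 = 1 then (1 : L) else 0)).Local v)
  (H' : Matrix (Fin 3) (Fin 3) L) (b : (UnitaryGroup.cmDatum L 3 H').Local v) (hw : IsCMField.complexConj L • w.1 = w.1)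

include hw in
/-- **`χ_g(u)` IS A UNIT once `v_w(χ_g(u)_w) ≠ 0`** at a non-split `v` (one place `w` over `v`: ★ `isUnit_localRing_of_ne_zero_of_subsingleton`) — discharges the `hu` of ★ (D2)
from any of the valuation readings below. [cite: Rogawski1990, §4.9 p. 55] -/
theorem isUnit_eval_finCharpolyTwo_of_valued_apply_ne_zero (hz : Valued.v (((finCharpolyTwo L v a).eval (finGammaTwo L v a)) w) ≠ 0) :
    IsUnit ((finCharpolyTwo L v a).eval (finGammaTwo L v a)) := by
  have hv : Subsingleton (UnitaryGroup.PlacesOver L v) :=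
    UnitaryGroup.PlacesOver.subsingleton_of_smul_eq (IsCMField.complexConj L) (IsCMField.complexConj_ne_one L) w hw
  refine isUnit_localRing_of_ne_zero_of_subsingleton L v hv fun h0 => hz ?_
  have hw0 : ((finCharpolyTwo L v a).eval (finGammaTwo L v a)) w = 0 := by rw [h0]; rfl
  rw [hw0, map_zero]

/-- **(M3a) `log v_w(χ_g(u)_w) = 2e − min(D, 2M)` ON THE DOMINATION ROW** (`v_w(2) = exp(−e)`, `v_w(tr g_w² − 4 det g_w) = exp(−D)`, `v_w(tr g_w − 2b) = exp(−M)`, `D ≠ 2M`):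
★ bridge `eval_finCharpolyTwo_finGammaTwo_apply_eq_quadratic` + §1.  At `e = 0`, `D = 2N+1` it is ★ `log_valued_eval_finCharpolyTwo_apply_eq_neg_min`.
[cite: Flicker1998UnitaryFL, §6 Thm. 18 p. 97] [cite: Rogawski1990, §4.9 p. 55, Prop. 4.9.1 (b)] -/
theorem log_valued_eval_finCharpolyTwo_apply_eq_of_ne {e D M : ℕ} (he : Valued.v (2 : w.1.adicCompletion L) = WithZero.exp (-(e : ℤ)))
    (hD : Valued.v (((a.1.val.val : Matrix (Fin 2) (Fin 2) (UnitaryGroup.LocalRing L v)).map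
          (Pi.evalRingHom (fun w' : UnitaryGroup.PlacesOver L v => w'.1.adicCompletion L) w)).trace ^ 2 -
        4 * ((a.1.val.val : Matrix (Fin 2) (Fin 2) (UnitaryGroup.LocalRing L v)).map
          (Pi.evalRingHom (fun w' : UnitaryGroup.PlacesOver L v => w'.1.adicCompletion L) w)).det) =
      WithZero.exp (-(D : ℤ)))
    (hM : Valued.v (((a.1.val.val : Matrix (Fin 2) (Fin 2) (UnitaryGroup.LocalRing L v)).map
          (Pi.evalRingHom (fun w' : UnitaryGroup.PlacesOver L v => w'.1.adicCompletion L) w)).trace - 2 * finGammaTwo L v a w) =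
      WithZero.exp (-(M : ℤ))) (hne : D ≠ 2 * M) :
    WithZero.log (Valued.v (((finCharpolyTwo L v a).eval (finGammaTwo L v a)) w)) = 2 * (e : ℤ) - ((min D (2 * M) : ℕ) : ℤ) := by
  rw [eval_finCharpolyTwo_finGammaTwo_apply_eq_quadratic L v w a]
  exact log_valued_quadratic_eval_eq_of_ne L v w he hD hM hne

include hw in
open scoped Classical in
/-- **(M3b) `Δ‴_v(γ_H, γ′) = (−q_v)^{2e − min(D, 2M)} · κ_v(γ_H, γ′)` ON THE DOMINATION ROW** (★ (D2) `finExplicitDelta_eq_neg_absNorm_zpow_mul_kappa_of_nonsplit_of_isUnramifiedIn` —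
its exponent is an integer `zpow`, so `2e − min(D, 2M) ≥ 0` is allowed — with the exponent read by (M3a); the unit hypothesis of ★ (D2) is discharged from `hD`∕`hM`):
non-split `v` unramified in `L` (any residue characteristic), `μ` unramified at `w` under the N7 μ-guard, a matching pair `ι_v(γ_H) ↔ γ′`.  At `e = 0`, `D = 2N+1`: ★
`finExplicitDelta_eq_neg_absNorm_zpow_neg_min_mul_kappa`. [cite: Flicker1998UnitaryFL, §6 Thm. 18 p. 97] [cite: Rogawski1990, §4.9 p. 55, Prop. 4.9.1 (b)] [cite: LanglandsShelstad1987, §3] -/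
theorem finExplicitDelta_eq_neg_absNorm_zpow_of_ne_mul_kappa (μ : HeckeCharacter L)
    (hμω : ∀ x : ideleGroup ↥(maximalRealSubfield L), μ (AdeleRing.ideleBaseChange ↥(maximalRealSubfield L) L x) = quadraticHeckeCharCM L x)
    (hunr : Algebra.IsUnramifiedIn (𝓞 L) v.asIdeal) (hμ : μ.IsUnramifiedAt w.1) (h : IsLocalNormPair L H' v a b)
    {e D M : ℕ} (he : Valued.v (2 : w.1.adicCompletion L) = WithZero.exp (-(e : ℤ)))
    (hD : Valued.v (((a.1.val.val : Matrix (Fin 2) (Fin 2) (UnitaryGroup.LocalRing L v)).map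
          (Pi.evalRingHom (fun w' : UnitaryGroup.PlacesOver L v => w'.1.adicCompletion L) w)).trace ^ 2 -
        4 * ((a.1.val.val : Matrix (Fin 2) (Fin 2) (UnitaryGroup.LocalRing L v)).map
          (Pi.evalRingHom (fun w' : UnitaryGroup.PlacesOver L v => w'.1.adicCompletion L) w)).det) =
      WithZero.exp (-(D : ℤ)))
    (hM : Valued.v (((a.1.val.val : Matrix (Fin 2) (Fin 2) (UnitaryGroup.LocalRing L v)).map
          (Pi.evalRingHom (fun w' : UnitaryGroup.PlacesOver L v => w'.1.adicCompletion L) w)).trace - 2 * finGammaTwo L v a w) =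
      WithZero.exp (-(M : ℤ))) (hne : D ≠ 2 * M) :
    finExplicitDelta L v H' a μ b = (-(Ideal.absNorm v.asIdeal : ℂ)) ^ (2 * (e : ℤ) - ((min D (2 * M) : ℕ) : ℤ)) * ((finKappaAt L v H' a b : ℤ) : ℂ) := by
  have hlog := log_valued_eval_finCharpolyTwo_apply_eq_of_ne L v w a he hD hM hne
  have hz : Valued.v (((finCharpolyTwo L v a).eval (finGammaTwo L v a)) w) ≠ 0 := by
    intro h0
    rw [eval_finCharpolyTwo_finGammaTwo_apply_eq_quadratic L v w a, valued_quadratic_eval_of_ne he hD hM hne] at h0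
    exact WithZero.exp_ne_zero h0
  have hu := isUnit_eval_finCharpolyTwo_of_valued_apply_ne_zero L v w a hw hz
  rw [finExplicitDelta_eq_neg_absNorm_zpow_mul_kappa_of_nonsplit_of_isUnramifiedIn L v H' a b w hw μ hμω hunr hμ h hu, hlog]

/-- **(M3c) `log v_w(χ_g(u)_w) = 2e − (2r + J)` ON THE CANCELLATION ROW** (`v_w(2) = exp(−e)`, a uniformiser `ϖ` of `L_w`, `v_w(tr g_w² − 4 det g_w) = exp(−2r)`,
`v_w(tr g_w − 2b) = exp(−r)`, `v_w(c₀² − η) = exp(−J)` for `c₀ = (tr g_w − 2b)∕ϖ^r`, `η = (tr g_w² − 4 det g_w)∕ϖ^{2r}`): `ord_w χ_g(u) = 2r + J − 2e`.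
[cite: Omeara1963, §63A 63:2–63:5] [cite: Rogawski1990, §4.9 p. 55] -/
theorem log_valued_eval_finCharpolyTwo_apply_eq_of_eq {e r J : ℕ} (he : Valued.v (2 : w.1.adicCompletion L) = WithZero.exp (-(e : ℤ)))
    {ϖ : w.1.adicCompletion L} (hϖ : Valued.v ϖ = WithZero.exp (-1 : ℤ))
    (hD : Valued.v (((a.1.val.val : Matrix (Fin 2) (Fin 2) (UnitaryGroup.LocalRing L v)).map
          (Pi.evalRingHom (fun w' : UnitaryGroup.PlacesOver L v => w'.1.adicCompletion L) w)).trace ^ 2 -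
        4 * ((a.1.val.val : Matrix (Fin 2) (Fin 2) (UnitaryGroup.LocalRing L v)).map
          (Pi.evalRingHom (fun w' : UnitaryGroup.PlacesOver L v => w'.1.adicCompletion L) w)).det) =
      WithZero.exp (-((2 * r : ℕ) : ℤ)))
    (hM : Valued.v (((a.1.val.val : Matrix (Fin 2) (Fin 2) (UnitaryGroup.LocalRing L v)).map
          (Pi.evalRingHom (fun w' : UnitaryGroup.PlacesOver L v => w'.1.adicCompletion L) w)).trace - 2 * finGammaTwo L v a w) =
      WithZero.exp (-(r : ℤ)))
    (hJ : Valued.v (((((a.1.val.val : Matrix (Fin 2) (Fin 2) (UnitaryGroup.LocalRing L v)).map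
            (Pi.evalRingHom (fun w' : UnitaryGroup.PlacesOver L v => w'.1.adicCompletion L) w)).trace - 2 * finGammaTwo L v a w) / ϖ ^ r) ^ 2 -
        (((a.1.val.val : Matrix (Fin 2) (Fin 2) (UnitaryGroup.LocalRing L v)).map
            (Pi.evalRingHom (fun w' : UnitaryGroup.PlacesOver L v => w'.1.adicCompletion L) w)).trace ^ 2 -
          4 * ((a.1.val.val : Matrix (Fin 2) (Fin 2) (UnitaryGroup.LocalRing L v)).map
            (Pi.evalRingHom (fun w' : UnitaryGroup.PlacesOver L v => w'.1.adicCompletion L) w)).det) / ϖ ^ (2 * r)) =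
      WithZero.exp (-(J : ℤ))) :
    WithZero.log (Valued.v (((finCharpolyTwo L v a).eval (finGammaTwo L v a)) w)) = 2 * (e : ℤ) - (2 * (r : ℤ) + (J : ℤ)) := by
  rw [eval_finCharpolyTwo_finGammaTwo_apply_eq_quadratic L v w a]
  exact log_valued_quadratic_eval_eq_of_eq L v w he hϖ hD hM hJ

include hw in
open scoped Classical in
/-- **(M3c) `Δ‴_v(γ_H, γ′) = (−q_v)^{2e − (2r + J)} · κ_v(γ_H, γ′)` ON THE CANCELLATION ROW** (★ (D2) with the exponent read by `log_valued_eval_finCharpolyTwo_apply_eq_of_eq`; unit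
hypothesis discharged): non-split `v` unramified in `L`, `μ` unramified at `w` under the N7 μ-guard, a matching pair. [cite: Rogawski1990, §4.9 p. 55, Prop. 4.9.1 (b)]
[cite: Omeara1963, §63A 63:2–63:5] [cite: LanglandsShelstad1987, §3] -/
theorem finExplicitDelta_eq_neg_absNorm_zpow_of_eq_mul_kappa (μ : HeckeCharacter L)
    (hμω : ∀ x : ideleGroup ↥(maximalRealSubfield L), μ (AdeleRing.ideleBaseChange ↥(maximalRealSubfield L) L x) = quadraticHeckeCharCM L x)
    (hunr : Algebra.IsUnramifiedIn (𝓞 L) v.asIdeal) (hμ : μ.IsUnramifiedAt w.1) (h : IsLocalNormPair L H' v a b)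
    {e r J : ℕ} (he : Valued.v (2 : w.1.adicCompletion L) = WithZero.exp (-(e : ℤ)))
    {ϖ : w.1.adicCompletion L} (hϖ : Valued.v ϖ = WithZero.exp (-1 : ℤ))
    (hD : Valued.v (((a.1.val.val : Matrix (Fin 2) (Fin 2) (UnitaryGroup.LocalRing L v)).map
          (Pi.evalRingHom (fun w' : UnitaryGroup.PlacesOver L v => w'.1.adicCompletion L) w)).trace ^ 2 -
        4 * ((a.1.val.val : Matrix (Fin 2) (Fin 2) (UnitaryGroup.LocalRing L v)).map
          (Pi.evalRingHom (fun w' : UnitaryGroup.PlacesOver L v => w'.1.adicCompletion L) w)).det) =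
      WithZero.exp (-((2 * r : ℕ) : ℤ)))
    (hM : Valued.v (((a.1.val.val : Matrix (Fin 2) (Fin 2) (UnitaryGroup.LocalRing L v)).map
          (Pi.evalRingHom (fun w' : UnitaryGroup.PlacesOver L v => w'.1.adicCompletion L) w)).trace - 2 * finGammaTwo L v a w) =
      WithZero.exp (-(r : ℤ)))
    (hJ : Valued.v (((((a.1.val.val : Matrix (Fin 2) (Fin 2) (UnitaryGroup.LocalRing L v)).map
            (Pi.evalRingHom (fun w' : UnitaryGroup.PlacesOver L v => w'.1.adicCompletion L) w)).trace - 2 * finGammaTwo L v a w) / ϖ ^ r) ^ 2 -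
        (((a.1.val.val : Matrix (Fin 2) (Fin 2) (UnitaryGroup.LocalRing L v)).map
            (Pi.evalRingHom (fun w' : UnitaryGroup.PlacesOver L v => w'.1.adicCompletion L) w)).trace ^ 2 -
          4 * ((a.1.val.val : Matrix (Fin 2) (Fin 2) (UnitaryGroup.LocalRing L v)).map
            (Pi.evalRingHom (fun w' : UnitaryGroup.PlacesOver L v => w'.1.adicCompletion L) w)).det) / ϖ ^ (2 * r)) =
      WithZero.exp (-(J : ℤ))) :
    finExplicitDelta L v H' a μ b = (-(Ideal.absNorm v.asIdeal : ℂ)) ^ (2 * (e : ℤ) - (2 * (r : ℤ) + (J : ℤ))) * ((finKappaAt L v H' a b : ℤ) : ℂ) := by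
  have hlog := log_valued_eval_finCharpolyTwo_apply_eq_of_eq L v w a he hϖ hD hM hJ
  have hz : Valued.v (((finCharpolyTwo L v a).eval (finGammaTwo L v a)) w) ≠ 0 := by
    intro h0
    rw [eval_finCharpolyTwo_finGammaTwo_apply_eq_quadratic L v w a, valued_quadratic_eval_eq_exp_of_eq L v w he hϖ hD hM hJ] at h0
    exact WithZero.exp_ne_zero h0
  have hu := isUnit_eval_finCharpolyTwo_of_valued_apply_ne_zero L v w a hw hz
  rw [finExplicitDelta_eq_neg_absNorm_zpow_mul_kappa_of_nonsplit_of_isUnramifiedIn L v H' a b w hw μ hμω hunr hμ h hu, hlog]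

end Carriers

end Literature.NumberTheory.Rogawski1990

end
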